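import Summits.BirchSwinnertonDyer.BirchSwinnertonDyer.Theorems.ManinLocalTwoThreeCuspValuesOfTranslatesPoles
import Literature.NumberTheory.EllipticCurves.EichlerShimuraPeriodsGamma1
import HarnessLib

/-!
# Cusp values along translates, III: the statements for presenting cusp forms on `Γ₁(N)` (what Shimura reciprocity on translates consumes)
(route `ManinLocalTwoThree`, crux C2 `ManinOddAtFour` stmt-BirchSwinnertonDyer-22967; cell bsd-f2-manin, prover seat p2 gen 23;
`--supports stmt-BirchSwinnertonDyer-22967`; sequel of `…CuspValuesOfTranslates` (p766229) and `…CuspValuesOfTranslatesPoles` (p766293);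
matches p3 gen 21's STEP (0) `StevensCurve.exists_rat_gamma1_presentation` — presenting forms `F, G ∈ S_k(Γ₁(N))` with `G·℘_Λ(c·ℰ_f) = F`)

For `F, G : CuspForm (Gamma1 N) k` presenting `℘_Λ(c·ℰ_f)` (resp. `℘_Λ'(c·ℰ_f)`) on `ℍ` off the poles, `f ≠ 0`, `c ≠ 0`, and `g ∈ SL₂(ℤ)` with
`g∞ ≠ ∞`, write `z₀ := c·{∞, g∞}_f` and let `m` be the first non-vanishing `q_N`-coefficient of the translate `G ∣[k] g` (an `N`-periodic
cuspidal `q`-series, `isCuspFunction_slash_gamma1`).  Then: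
* `coeff_slash_eq_weierstrassP_mul` — if `z₀ ∉ Λ`: `coeff_n(F ∣[k] g) = 0` for `n < m` and `coeff_m(F ∣[k] g) = ℘_Λ(z₀)·coeff_m(G ∣[k] g)`
  (so `x(π(z₀)) = ℘_Λ(z₀) − b₂/12` is a RATIO OF `q_N`-COEFFICIENTS of translates); `coeff_slash_eq_derivWeierstrassP_mul` — the `℘_Λ'` twin;
* `mem_lattice_iff_exists_coeff_ne_zero` — `z₀ ∈ Λ` (the cusp value is `O`) iff some `coeff_n(F ∣[k] g)`, `n < m`, is nonzero.
A Galois action `σ` on the `q_N`-coefficients of translates with `σ(coeff_n(F ∣ g)) = coeff_n(F ∣ g′)` (the LEAD's step (1), Shimura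
reciprocity) therefore maps `O ↦ O` and `(x, y)(P_{g∞}) ↦ (x, y)(P_{g′∞})` — Stevens' formula.  Fact-free; nothing about T-es-75, C2,
Manin's conjecture or BSD is proved here.  No definitions, no sorry.
[cite: Manin1972, Prop. 1.4 and §1.5] [cite: ShimuraIATAF1971, §6.1–6.2] [cite: Stevens1982, §1.3 Thm. 1.3.1]
-/

set_option autoImplicit false
-- lint-debt: the directory name repeats the summit name (sibling precedent `ManinLocalTwoThreeCuspValuesOfTranslatesPoles.lean`)
set_option linter.dupNamespace false

noncomputable section

open scoped MatrixGroups ModularForm Topology PeriodPair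
open Complex Filter Function CongruenceSubgroup
open UpperHalfPlane hiding I
open Literature.NumberTheory.EllipticCurves Literature.NumberTheory.EllipticCurves.ModularForms

namespace Summit.BirchSwinnertonDyer.BirchSwinnertonDyer.Theorems.ManinLocalTwoThree.CuspValues

variable {N : ℕ} [NeZero N] {k : ℤ}

/-- The translate `F ∣[k] g` of a cusp form on `Γ₁(N)` is `N`-periodic. [folklore] -/
theorem periodic_slash_gamma1' (F : CuspForm (Gamma1 N) k) (g : SL(2, ℤ)) :
    Periodic ((⇑F ∣[k] g) ∘ ofComplex) ((N : ℕ) : ℝ) :=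
  (isCuspFunction_slash_gamma1 F g).periodic

/-- The translate `F ∣[k] g` of a cusp form on `Γ₁(N)` has an analytic cusp function at `q_N = 0`. [folklore] -/
theorem analyticAt_cuspFunction_slash_gamma1 (F : CuspForm (Gamma1 N) k) (g : SL(2, ℤ)) :
    AnalyticAt ℂ (cuspFunction ((N : ℕ) : ℝ) (⇑F ∣[k] g)) 0 := by
  have hφ := isCuspFunction_slash_gamma1 F g
  exact analyticAt_cuspFunction_zero hφ.pos hφ.periodic hφ.mdifferentiable hφ.isZeroAtImInfty.boundedAtFilter

/-- **The `x`-coordinate of the cusp value `π(c·{∞,g∞}_f)` as a ratio of `q_N`-coefficients of translates.**  For `F, G ∈ S_k(Γ₁(N))`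
with `G·℘_Λ(c·ℰ_f) = F` off the poles, `f ≠ 0`, `c ≠ 0`, `g∞ ≠ ∞`, `z₀ = c·{∞,g∞}_f ∉ Λ` and `m` the first non-vanishing `q_N`-coefficient of
`G ∣[k] g`: `coeff_n(F ∣[k] g) = 0` (`n < m`) and `coeff_m(F ∣[k] g) = ℘_Λ(z₀)·coeff_m(G ∣[k] g)`.  Fact-free.
[cite: Manin1972, Prop. 1.4 and §1.5] [cite: ShimuraIATAF1971, §6.1–6.2] -/
theorem coeff_slash_eq_weierstrassP_mul (f : CuspForm (Gamma0 N) 2) (hf : f ≠ 0) (L : PeriodPair) (F G : CuspForm (Gamma1 N) k)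
    {c : ℂ} (hc : c ≠ 0) (hpres : ∀ τ : ℍ, c * eichlerIntegral f τ ∉ L.lattice → G τ * ℘[L] (c * eichlerIntegral f τ) = F τ)
    (g : SL(2, ℤ)) (hg : (g 1 0 : ℤ) ≠ 0) (hz₀ : c * modularSymbol f (((g 0 0 : ℤ) : ℚ) / ((g 1 0 : ℤ) : ℚ)) ∉ L.lattice)
    {m : ℕ} (hGm : (qExpansion ((N : ℕ) : ℝ) (⇑G ∣[k] g)).coeff m ≠ 0)
    (hGlt : ∀ n < m, (qExpansion ((N : ℕ) : ℝ) (⇑G ∣[k] g)).coeff n = 0) :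
    (∀ n < m, (qExpansion ((N : ℕ) : ℝ) (⇑F ∣[k] g)).coeff n = 0) ∧
      (qExpansion ((N : ℕ) : ℝ) (⇑F ∣[k] g)).coeff m =
        ℘[L] (c * modularSymbol f (((g 0 0 : ℤ) : ℚ) / ((g 1 0 : ℤ) : ℚ))) * (qExpansion ((N : ℕ) : ℝ) (⇑G ∣[k] g)).coeff m :=
  qExpansion_coeff_eq_weierstrassP_mul_of_presentation (Nat.cast_pos.mpr (NeZero.pos N)) f L g hg c hz₀
    (periodic_slash_gamma1' F g) (analyticAt_cuspFunction_slash_gamma1 F g)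
    (periodic_slash_gamma1' G g) (analyticAt_cuspFunction_slash_gamma1 G g)
    (eventually_slash_presentation f hf L g hg hc k hpres) hGm hGlt

/-- **The `y`-coordinate**: the same for a `℘_Λ'`-presentation `Gʸ·℘_Λ'(c·ℰ_f) = Fʸ`.  Fact-free. [cite: Manin1972, Prop. 1.4 and §1.5] -/
theorem coeff_slash_eq_derivWeierstrassP_mul (f : CuspForm (Gamma0 N) 2) (hf : f ≠ 0) (L : PeriodPair) (F G : CuspForm (Gamma1 N) k)
    {c : ℂ} (hc : c ≠ 0) (hpres : ∀ τ : ℍ, c * eichlerIntegral f τ ∉ L.lattice → G τ * ℘'[L] (c * eichlerIntegral f τ) = F τ)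
    (g : SL(2, ℤ)) (hg : (g 1 0 : ℤ) ≠ 0) (hz₀ : c * modularSymbol f (((g 0 0 : ℤ) : ℚ) / ((g 1 0 : ℤ) : ℚ)) ∉ L.lattice)
    {m : ℕ} (hGm : (qExpansion ((N : ℕ) : ℝ) (⇑G ∣[k] g)).coeff m ≠ 0)
    (hGlt : ∀ n < m, (qExpansion ((N : ℕ) : ℝ) (⇑G ∣[k] g)).coeff n = 0) :
    (∀ n < m, (qExpansion ((N : ℕ) : ℝ) (⇑F ∣[k] g)).coeff n = 0) ∧
      (qExpansion ((N : ℕ) : ℝ) (⇑F ∣[k] g)).coeff m =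
        ℘'[L] (c * modularSymbol f (((g 0 0 : ℤ) : ℚ) / ((g 1 0 : ℤ) : ℚ))) * (qExpansion ((N : ℕ) : ℝ) (⇑G ∣[k] g)).coeff m :=
  qExpansion_coeff_eq_derivWeierstrassP_mul_of_presentation (Nat.cast_pos.mpr (NeZero.pos N)) f L g hg c hz₀
    (periodic_slash_gamma1' F g) (analyticAt_cuspFunction_slash_gamma1 F g)
    (periodic_slash_gamma1' G g) (analyticAt_cuspFunction_slash_gamma1 G g)
    (eventually_slash_presentation f hf L g hg hc k hpres) hGm hGlt

/-- **The cusp value is `O` iff a low coefficient survives**: with a `℘_Λ`-presentation as above, `c·{∞,g∞}_f ∈ Λ` iff `coeff_n(F ∣[k] g) ≠ 0`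
for some `n` below the first non-vanishing coefficient of `G ∣[k] g`.  (A Galois action preserving vanishing of coefficients of translates
preserves «the cusp maps to `O`».)  Fact-free. [cite: Manin1972, §1.5] -/
theorem mem_lattice_iff_exists_coeff_ne_zero (f : CuspForm (Gamma0 N) 2) (hf : f ≠ 0) (L : PeriodPair) (F G : CuspForm (Gamma1 N) k)
    {c : ℂ} (hc : c ≠ 0) (hpres : ∀ τ : ℍ, c * eichlerIntegral f τ ∉ L.lattice → G τ * ℘[L] (c * eichlerIntegral f τ) = F τ)
    (g : SL(2, ℤ)) (hg : (g 1 0 : ℤ) ≠ 0)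
    {m : ℕ} (hGm : (qExpansion ((N : ℕ) : ℝ) (⇑G ∣[k] g)).coeff m ≠ 0)
    (hGlt : ∀ n < m, (qExpansion ((N : ℕ) : ℝ) (⇑G ∣[k] g)).coeff n = 0) :
    c * modularSymbol f (((g 0 0 : ℤ) : ℚ) / ((g 1 0 : ℤ) : ℚ)) ∈ L.lattice ↔
      ∃ n < m, (qExpansion ((N : ℕ) : ℝ) (⇑F ∣[k] g)).coeff n ≠ 0 := by
  constructor
  · intro hz₀
    exact exists_coeff_ne_zero_of_mem_lattice (Nat.cast_pos.mpr (NeZero.pos N)) f hf L g hg hc hz₀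
      (periodic_slash_gamma1' F g) (analyticAt_cuspFunction_slash_gamma1 F g)
      (periodic_slash_gamma1' G g) (analyticAt_cuspFunction_slash_gamma1 G g)
      (eventually_slash_presentation f hf L g hg hc k hpres) hGm hGlt
  · rintro ⟨n, hn, hne⟩
    by_contra hz₀
    exact hne ((coeff_slash_eq_weierstrassP_mul f hf L F G hc hpres g hg hz₀ hGm hGlt).1 n hn)

end Summit.BirchSwinnertonDyer.BirchSwinnertonDyer.Theorems.ManinLocalTwoThree.CuspValues

end
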